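import Mathlib.FieldTheory.AlgebraicClosure
import Mathlib.Algebra.Polynomial.Div
import Summits.KontsevichZagierPeriods.KontsevichZagierPeriods.Theorems.HurwitzMicroSectorsNormalFormPrincipleSplitMoves
import Summits.KontsevichZagierPeriods.KontsevichZagierPeriods.Theorems.HurwitzMicroSectorsNormalFormPrincipleAlgDlogMoves
import Summits.KontsevichZagierPeriods.KontsevichZagierPeriods.Theorems.HurwitzMicroSectorsNormalFormPrincipleDlogMoves
import Summits.KontsevichZagierPeriods.KontsevichZagierPeriods.Theorems.HurwitzMicroSectorsNormalFormPrincipleAlgSplitK5Kit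
import Summits.KontsevichZagierPeriods.KontsevichZagierPeriods.Theorems.HurwitzMicroSectorsNormalFormPrincipleCarrierAMulSiegeK8

/-!
# `NormalFormPrinciple` (stmt-KontsevichZagierPeriods-3869), line `SketchIdeator1` —
# the leaf `stub_boxRigidity` in dimension one — real algebraic toolkit and the dlog carriers `Λ(a,b,c)`

Pure proof file (lead seat c3; `--supports` the crux). Point representations with real algebraic
constant (`exists_ptCarrierA`), algebraicity of `K`-polynomial values at algebraic points
(`K = algebraicClosure ℚ ℝ`), and the calculus of a fixed family of dlog carriers
`RA a b c = [(a,b), c/y]` with real algebraic data modulo Kontsevich–Zagier relations: powers,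
additivity and `ℤ`-linearity in `c`, finite sums, and `carrierA_interval_eq`
(`[(a,b), c/y] = Λ(b/a, c)`). The real-algebraic toolkit (`isAlgebraic_coeK`,
`isSemialgebraicFunOn_aevalK(_div)`, `exists_repK_unit`, `exists_polynomial_hasDerivAtK`) and the
multiplicativity `carrierA_mul_mem_relations` are the sibling files `…AlgSplitK5Kit`,
`…CarrierAMulSiegeK8`.

Sources: M. Kontsevich, D. Zagier, *Periods* (2001), §1.2 rules (1), (2). No definitions are introduced.
-/

noncomputable section

open MeasureTheory Set Finset
open scoped Polynomial
open Literature.NumberTheory.Transcendental Literature.NumberTheory.Transcendental.KZ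
open Literature.ModelTheory.ExponentialFields (IsSemialgebraic isSemialgebraic_univ)

namespace Summit.KontsevichZagierPeriods.HurwitzMicroSectors.NormalFormPrinciple.PiBox

namespace Dlog

open Summit.KontsevichZagierPeriods.KontsevichZagierPeriods.BetaCancellationLine
  (aff_hasFDerivAt_chart aff_abs_det_chartDeriv aff_injective_chart aff_isSemialgebraicMapOn_chart)
open Summit.KontsevichZagierPeriods.HurwitzMicroSectors.NormalFormPrinciple.Negative
  (setIntegral_fin_one integrableOn_fin_one)
open Summit.KontsevichZagierPeriods.KontsevichZagierPeriods.BetaCancellationNegative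
  (volume_setOf_apply_eq_zero)
open Literature.NumberTheory.Transcendental.KZ.BallPeeling (isSemialgebraic_Ioo₁)

/-! ## Real algebraic numbers and polynomials over them -/

/-- The evaluation of a polynomial with real algebraic coefficients is algebraic at an algebraic
point. [folklore] -/
theorem isAlgebraic_aevalK (P : (algebraicClosure ℚ ℝ)[X]) {t : ℝ} (ht : IsAlgebraic ℚ t) :
    IsAlgebraic ℚ (Polynomial.aeval t P : ℝ) := by
  set tK : algebraicClosure ℚ ℝ := ⟨t, mem_algebraicClosure_iff.mpr ht⟩ with htK
  have h := Polynomial.aeval_algebraMap_apply_eq_algebraMap_eval (A := ℝ) tK P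
  have e : algebraMap (algebraicClosure ℚ ℝ) ℝ tK = t := rfl
  rw [e] at h
  rw [h]
  exact AlgSplitK5.isAlgebraic_coeK (P.eval tK)

/-! ## Point representations with an algebraic constant -/

/-- **A family of point representations** `[pt, r]` for real algebraic `r` (junk otherwise).
[cite: KontsevichZagier2001, §1.1] -/
theorem exists_ptCarrierA :
    ∃ Z : ℝ → IntegralRep 0, ∀ r, IsAlgebraic ℚ r → (Z r).domain = univ ∧ (Z r).integrand = fun _ => r := by
  classical
  refine ⟨fun r => if h : IsAlgebraic ℚ r then
    { domain := univ
      integrand := fun _ => r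
      isSemialgebraic_domain := isSemialgebraic_univ
      isSemialgebraicFunOn_integrand := isSemialgebraicFunOn_const_of_isAlgebraic isSemialgebraic_univ h
      integrableOn := integrableOn_const (hs := by simp [volume_univ_fin_zero]) }
    else IntegralRep.empty 0, fun r hr => ?_⟩
  dsimp only
  rw [dif_pos hr]
  exact ⟨rfl, rfl⟩

/-! ## The carrier family -/

/-- **A family of dlog carriers with algebraic data**: `R a b c = [(a,b), c/y]` whenever `a, b, c` are
real algebraic and `0 < a` (junk otherwise). [cite: KontsevichZagier2001, §1.1] -/
theorem exists_carrierA :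
    ∃ R : ℝ → ℝ → ℝ → IntegralRep 1, ∀ a b c, IsAlgebraic ℚ a → IsAlgebraic ℚ b → IsAlgebraic ℚ c →
      0 < a → (R a b c).domain = {x | x 0 ∈ Set.Ioo a b} ∧ (R a b c).integrand = fun x => c / x 0 := by
  classical
  refine ⟨fun a b c => if h : IsAlgebraic ℚ a ∧ IsAlgebraic ℚ b ∧ IsAlgebraic ℚ c ∧ 0 < a then
    Classical.choose (exists_dlogA h.1 h.2.1 h.2.2.1 h.2.2.2) else IntegralRep.empty 1,
    fun a b c ha hb hc ha0 => ?_⟩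
  simp only [dif_pos (show IsAlgebraic ℚ a ∧ IsAlgebraic ℚ b ∧ IsAlgebraic ℚ c ∧ 0 < a from
    ⟨ha, hb, hc, ha0⟩)]
  exact Classical.choose_spec (exists_dlogA ha hb hc ha0)

variable {R : ℝ → ℝ → ℝ → IntegralRep 1}

/-- `Λ(1, c) ∈ relations` (empty slab). [cite: KontsevichZagier2001, §1.2 rule (1)] -/
theorem carrierA_one_mem_relations {R : ℝ → ℝ → ℝ → IntegralRep 1}
    (hR : ∀ a b c, IsAlgebraic ℚ a → IsAlgebraic ℚ b → IsAlgebraic ℚ c → 0 < a →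
      (R a b c).domain = {x | x 0 ∈ Set.Ioo a b} ∧ (R a b c).integrand = fun x => c / x 0)
    {c : ℝ} (hc : IsAlgebraic ℚ c) : of (R 1 1 c) ∈ relations :=
  slab_empty_mem_relations _ (hR 1 1 c isAlgebraic_one isAlgebraic_one hc one_pos).1 le_rfl

/-- **Powers**: `Λ(uⁿ, c) = n • Λ(u, c)` in `FormalRep ⧸ relations` for algebraic `u ≥ 1`.
[cite: KontsevichZagier2001, §1.2 rules (1), (2)] -/
theorem carrierA_pow_eq {R : ℝ → ℝ → ℝ → IntegralRep 1}
    (hR : ∀ a b c, IsAlgebraic ℚ a → IsAlgebraic ℚ b → IsAlgebraic ℚ c → 0 < a →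
      (R a b c).domain = {x | x 0 ∈ Set.Ioo a b} ∧ (R a b c).integrand = fun x => c / x 0)
    {u c : ℝ} (hu : IsAlgebraic ℚ u) (hc : IsAlgebraic ℚ c) (hu1 : 1 ≤ u) (n : ℕ) :
    QuotientAddGroup.mk' relations (of (R 1 (u ^ n) c)) =
      n • QuotientAddGroup.mk' relations (of (R 1 u c)) := by
  induction n with
  | zero =>
    rw [pow_zero, zero_smul]
    exact (QuotientAddGroup.eq_zero_iff _).mpr (carrierA_one_mem_relations hR hc)
  | succ n ih =>
    have h := CarrierSiegeK8.carrierA_mul_mem_relations hR (hu.pow n) hu hc (one_le_pow₀ hu1) hu1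
    rw [← QuotientAddGroup.eq_zero_iff] at h
    change QuotientAddGroup.mk' relations _ = 0 at h
    rw [map_sub, map_sub, sub_sub, sub_eq_zero] at h
    rw [pow_succ, h, ih, add_smul, one_smul]

/-- **Additivity in the constant**: `Λ(u, c + c') − Λ(u, c) − Λ(u, c') ∈ relations`.
[cite: KontsevichZagier2001, §1.2 rule (1)] -/
theorem carrierA_add_mem_relations {R : ℝ → ℝ → ℝ → IntegralRep 1}
    (hR : ∀ a b c, IsAlgebraic ℚ a → IsAlgebraic ℚ b → IsAlgebraic ℚ c → 0 < a →
      (R a b c).domain = {x | x 0 ∈ Set.Ioo a b} ∧ (R a b c).integrand = fun x => c / x 0)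
    {u c c' : ℝ} (hu : IsAlgebraic ℚ u) (hc : IsAlgebraic ℚ c) (hc' : IsAlgebraic ℚ c') :
    of (R 1 u (c + c')) - of (R 1 u c) - of (R 1 u c') ∈ relations :=
  dlogA_merge_mem_relations (σ := {x | x 0 ∈ Set.Ioo (1:ℝ) u}) (c := c) (c' := c') _ _ _
    (hR 1 u (c + c') isAlgebraic_one hu (hc.add hc') one_pos).1
    (hR 1 u c isAlgebraic_one hu hc one_pos).1 (hR 1 u c' isAlgebraic_one hu hc' one_pos).1
    (by rw [(hR 1 u (c + c') isAlgebraic_one hu (hc.add hc') one_pos).2]; exact fun _ _ => rfl)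
    (by rw [(hR 1 u c isAlgebraic_one hu hc one_pos).2]; exact fun _ _ => rfl)
    (by rw [(hR 1 u c' isAlgebraic_one hu hc' one_pos).2]; exact fun _ _ => rfl)

/-- `Λ(u, 0) ∈ relations`. [cite: KontsevichZagier2001, §1.2 rule (1)] -/
theorem carrierA_zero_mem_relations {R : ℝ → ℝ → ℝ → IntegralRep 1}
    (hR : ∀ a b c, IsAlgebraic ℚ a → IsAlgebraic ℚ b → IsAlgebraic ℚ c → 0 < a →
      (R a b c).domain = {x | x 0 ∈ Set.Ioo a b} ∧ (R a b c).integrand = fun x => c / x 0)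
    {u : ℝ} (hu : IsAlgebraic ℚ u) : of (R 1 u 0) ∈ relations :=
  dlogA_zero_mem_relations _
    (by rw [(hR 1 u 0 isAlgebraic_one hu isAlgebraic_zero one_pos).2]; exact fun _ _ => rfl)

/-- Additivity in the quotient. [cite: KontsevichZagier2001, §1.2 rule (1)] -/
theorem carrierA_add_eq {R : ℝ → ℝ → ℝ → IntegralRep 1}
    (hR : ∀ a b c, IsAlgebraic ℚ a → IsAlgebraic ℚ b → IsAlgebraic ℚ c → 0 < a →
      (R a b c).domain = {x | x 0 ∈ Set.Ioo a b} ∧ (R a b c).integrand = fun x => c / x 0)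
    {u c c' : ℝ} (hu : IsAlgebraic ℚ u) (hc : IsAlgebraic ℚ c) (hc' : IsAlgebraic ℚ c') :
    QuotientAddGroup.mk' relations (of (R 1 u (c + c'))) =
      QuotientAddGroup.mk' relations (of (R 1 u c)) + QuotientAddGroup.mk' relations (of (R 1 u c')) := by
  have h := carrierA_add_mem_relations hR hu hc hc'
  rw [← QuotientAddGroup.eq_zero_iff] at h
  change QuotientAddGroup.mk' relations _ = 0 at h
  rwa [map_sub, map_sub, sub_sub, sub_eq_zero] at h

/-- Negation in the quotient: `Λ(u, −c) = −Λ(u, c)`. [cite: KontsevichZagier2001, §1.2 rule (1)] -/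
theorem carrierA_neg_eq {R : ℝ → ℝ → ℝ → IntegralRep 1}
    (hR : ∀ a b c, IsAlgebraic ℚ a → IsAlgebraic ℚ b → IsAlgebraic ℚ c → 0 < a →
      (R a b c).domain = {x | x 0 ∈ Set.Ioo a b} ∧ (R a b c).integrand = fun x => c / x 0)
    {u c : ℝ} (hu : IsAlgebraic ℚ u) (hc : IsAlgebraic ℚ c) :
    QuotientAddGroup.mk' relations (of (R 1 u (-c))) = -QuotientAddGroup.mk' relations (of (R 1 u c)) := by
  have h := carrierA_add_eq hR hu hc hc.neg
  have h0 : QuotientAddGroup.mk' relations (of (R 1 u 0)) = 0 :=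
    (QuotientAddGroup.eq_zero_iff _).mpr (carrierA_zero_mem_relations hR hu)
  rw [add_neg_cancel, h0] at h
  exact (neg_eq_of_add_eq_zero_right h.symm).symm

/-- Integer multiples: `z • Λ(u, c) = Λ(u, z c)`. [cite: KontsevichZagier2001, §1.2 rule (1)] -/
theorem carrierA_zsmul_eq {R : ℝ → ℝ → ℝ → IntegralRep 1}
    (hR : ∀ a b c, IsAlgebraic ℚ a → IsAlgebraic ℚ b → IsAlgebraic ℚ c → 0 < a →
      (R a b c).domain = {x | x 0 ∈ Set.Ioo a b} ∧ (R a b c).integrand = fun x => c / x 0)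
    {u c : ℝ} (hu : IsAlgebraic ℚ u) (hc : IsAlgebraic ℚ c) (z : ℤ) :
    z • QuotientAddGroup.mk' relations (of (R 1 u c)) =
      QuotientAddGroup.mk' relations (of (R 1 u ((z:ℝ) * c))) := by
  -- natural multiples first
  have hnat : ∀ n : ℕ, n • QuotientAddGroup.mk' relations (of (R 1 u c)) =
      QuotientAddGroup.mk' relations (of (R 1 u ((n:ℝ) * c))) := by
    intro n
    induction n with
    | zero =>
      rw [zero_smul, Nat.cast_zero, zero_mul]
      exact ((QuotientAddGroup.eq_zero_iff _).mpr (carrierA_zero_mem_relations hR hu)).symm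
    | succ n ih =>
      rw [add_smul, one_smul, ih, Nat.cast_succ, add_mul, one_mul,
        carrierA_add_eq hR hu ((isAlgebraic_nat (R := ℚ) n).mul hc) hc]
  cases z with
  | ofNat n =>
    rw [Int.ofNat_eq_natCast, natCast_zsmul, hnat n, Int.cast_natCast]
  | negSucc n =>
    rw [negSucc_zsmul, hnat (n + 1), Int.cast_negSucc, neg_mul,
      carrierA_neg_eq hR hu ((isAlgebraic_nat (R := ℚ) (n + 1)).mul hc)]

/-- Finite sums in the constant: `Λ(u, Σᵢ fᵢ) = Σᵢ Λ(u, fᵢ)` for algebraic `fᵢ`.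
[cite: KontsevichZagier2001, §1.2 rule (1)] -/
theorem carrierA_sum_eq {R : ℝ → ℝ → ℝ → IntegralRep 1} {ι : Type*} (s : Finset ι) (f : ι → ℝ)
    (hR : ∀ a b c, IsAlgebraic ℚ a → IsAlgebraic ℚ b → IsAlgebraic ℚ c → 0 < a →
      (R a b c).domain = {x | x 0 ∈ Set.Ioo a b} ∧ (R a b c).integrand = fun x => c / x 0)
    {u : ℝ} (hu : IsAlgebraic ℚ u) (hf : ∀ i ∈ s, IsAlgebraic ℚ (f i)) :
    QuotientAddGroup.mk' relations (of (R 1 u (∑ i ∈ s, f i))) =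
      ∑ i ∈ s, QuotientAddGroup.mk' relations (of (R 1 u (f i))) := by
  classical
  induction s using Finset.induction_on with
  | empty =>
    rw [Finset.sum_empty, Finset.sum_empty]
    exact (QuotientAddGroup.eq_zero_iff _).mpr (carrierA_zero_mem_relations hR hu)
  | insert i s hi ih =>
    rw [Finset.sum_insert hi, Finset.sum_insert hi,
      carrierA_add_eq hR hu (hf i (Finset.mem_insert_self i s))
        (Finset.sum_induction _ (IsAlgebraic ℚ) (fun _ _ ha hb => ha.add hb) isAlgebraic_zero fun j hj => hf j (Finset.mem_insert_of_mem hj)),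
      ih fun j hj => hf j (Finset.mem_insert_of_mem hj)]

/-- **An interval on one carrier**: for real algebraic `0 < a < b` and algebraic `c`,
`[(a,b), c/y] = Λ(b/a, c)` in `FormalRep ⧸ relations` (scale by `a⁻¹`).
[cite: KontsevichZagier2001, §1.2 rule (2)] -/
theorem carrierA_interval_eq {R : ℝ → ℝ → ℝ → IntegralRep 1}
    (hR : ∀ a b c, IsAlgebraic ℚ a → IsAlgebraic ℚ b → IsAlgebraic ℚ c → 0 < a →
      (R a b c).domain = {x | x 0 ∈ Set.Ioo a b} ∧ (R a b c).integrand = fun x => c / x 0)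
    {a b c : ℝ} (ha : IsAlgebraic ℚ a) (hb : IsAlgebraic ℚ b) (hc : IsAlgebraic ℚ c) (ha0 : 0 < a)
    (L : IntegralRep 1) (hd : L.domain = {x | x 0 ∈ Set.Ioo a b})
    (hi : EqOn L.integrand (fun x => c / x 0) L.domain) :
    QuotientAddGroup.mk' relations (of L) = QuotientAddGroup.mk' relations (of (R 1 (b / a) c)) := by
  have h1 := hR 1 (b / a) c isAlgebraic_one (hb.mul ha.inv) hc one_pos
  have hscale : of L - of (R 1 (b / a) c) ∈ relations :=
    dlogA_scale_mem_relations (s := a⁻¹) ha.inv L _ hd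
      (by rw [h1.1, inv_mul_cancel₀ ha0.ne', ← div_eq_inv_mul]) hi
      (by rw [h1.2]; exact fun _ _ => rfl) ha0 (inv_pos.mpr ha0)
  rw [← QuotientAddGroup.eq_zero_iff] at hscale
  change QuotientAddGroup.mk' relations _ = 0 at hscale
  rwa [map_sub, sub_eq_zero] at hscale

end Dlog

end Summit.KontsevichZagierPeriods.HurwitzMicroSectors.NormalFormPrinciple.PiBox
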